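import Summits.AtomisticToContinuum.Crystallization.Theorems.PricedLinkCensusLocalToGlobalPhaseGapDefs

/-!
# Crux `LocalToGlobal` (stmt-AtomisticToContinuum-14232), line `phase-gap-rate-upgrade`: Sub₁ implies its
# periodic form

The converse of `qualitativeChargeGap_of_periodicPhaseGap` (`PricedLinkCensusLocalToGlobalPhaseGapDefs.lean`):
**`periodicPhaseGap_of_qualitativeChargeGap : 0 ≤ η → η ≤ 1 → QualitativeChargeGapWith η → PeriodicPhaseGapWith η`**,
so that the finite-`N` phase gap Sub₁ and its periodic twin are EQUIVALENT
(`qualitativeChargeGap_iff_periodicPhaseGap`) and the line loses nothing by registering the periodic form.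

Proof (block trial states, exactly as `ChargedEnergyGapNegative.Blocks.periodicPricing_of_noBoundary`): given
`ρ > 0` take the gap `g = g(ρ/2)` of Sub₁.  For a periodic `Q` whose motif `F` has charged fraction `≥ ρ`, the block
of side `K` (`Blocks.blockConfig Q K`, `#F·K³` points, injective) has at least `(K³ − 6·lvl3·K²)·motifCharged`
charged sites (`Blocks.card_charged_block_ge`, `Blocks.card_deep_ge`), which is `≥ (ρ/2)·#F·K³` once `K ≥ 12·lvl3`;
so Sub₁ gives `#F K³ (e* + g) ≤ E_LJ(block)`, while blocks are trial states
(`Blocks.exists_block_energy_le`: `E_LJ(block) ≤ #F K³ (e(Q) + ε)` for large `K`).  Hence `e* + g ≤ e(Q) + ε` for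
every `ε > 0`.

Corollaries: the equivalence, and the periodic twin of the route target `ZeroChargeBulk` under Sub₁ — along every
minimising sequence of periodic configurations the charged fraction tends to `0`
(`tendsto_periodic_chargedFraction_of_qualitativeChargeGap`).  All `[folklore]`.
-/

noncomputable section

namespace Summit.AtomisticToContinuum.Crystallization.Theorems.PricedLinkCensusLocalToGlobalPhaseGap

open Literature.MathematicalPhysics.StatisticalMechanics
open Literature.Geometry.DiscreteGeometry
open Summit.AtomisticToContinuum.Crystallization.Theses.PricedLinkCensus
open Summit.AtomisticToContinuum.Crystallization.Theorems.ChargedEnergyGapNegative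
open Summit.AtomisticToContinuum.Crystallization.Theorems.ChargedEnergyGapNegative.Blocks
open scoped BigOperators Topology
open Filter

/-! ## The phase gap passes to periodic configurations through blocks -/

/-- **Blocks transfer the phase gap to periodic configurations**: if `PhaseGapWith η (ρ/2) g` (`0 ≤ η ≤ 1`,
`0 ≤ ρ`) and the motif of the periodic configuration `Q` has charged fraction `≥ ρ` at tolerance `η`, then
`e* + g ≤ e(Q)`.  The block of side `K ≥ 12·lvl3` has `≥ (ρ/2)·#F K³` charged sites and energy
`≤ #F K³ (e(Q) + ε)` for large `K`. [folklore] -/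
theorem le_energyPerParticle_of_phaseGapWith {η ρ g : ℝ} (hη0 : 0 ≤ η) (hη1 : η ≤ 1) (hρ : 0 ≤ ρ)
    (hP : PhaseGapWith η (ρ / 2) g) {Q : PeriodicConfiguration 3} (hQ : ρ ≤ chargedFraction η Q) :
    eStar + g ≤ Q.energyPerParticle lennardJones := by
  have hF : (0 : ℝ) < Q.motif.card := by exact_mod_cast Q.motif_nonempty.card_pos
  have hρF : ρ * Q.motif.card ≤ (motifCharged η Q : ℝ) := by
    have h := hQ
    rw [chargedFraction, le_div_iff₀ hF] at h
    exact h
  refine le_of_forall_pos_le_add fun ε hε => ?_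
  -- blocks are trial states with slack `ε` per particle
  obtain ⟨K₀, hK₀, hK⟩ := exists_block_energy_le Q hε
  -- a large `K`: beyond `K₀` and beyond `12·lvl3`
  obtain ⟨K, hKK₀, hK12⟩ : ∃ K : ℕ, K₀ ≤ K ∧ 12 * lvl3 Q ≤ K :=
    ⟨max K₀ (12 * lvl3 Q), le_max_left _ _, le_max_right _ _⟩
  have hKpos : (0 : ℝ) < K := by exact_mod_cast lt_of_lt_of_le hK₀ hKK₀
  have hK12r : (12 : ℝ) * (lvl3 Q) ≤ K := by exact_mod_cast hK12
  have hn : ((Fintype.card (BIdx Q K) : ℕ) : ℝ) = Q.motif.card * (K : ℝ) ^ 3 := by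
    exact_mod_cast card_BIdx Q K
  -- charged block points: at least `(K³ − 6·lvl3·K²)·mC`
  have hch := card_charged_block_ge Q K hη0 hη1 (η := η)
  have hdeep := card_deep_ge K (lvl3 Q)
  have hchR : ((K : ℝ) ^ 3 - 6 * (lvl3 Q) * (K : ℝ) ^ 2) * (motifCharged η Q : ℝ) ≤
      (Nat.card {u : BIdx Q K // ¬ IsChargeFree η (bpt Q K) u} : ℝ) := by
    have h1 : ((K : ℝ) ^ 3 - 6 * (lvl3 Q) * (K : ℝ) ^ 2) ≤
        (Nat.card {k : Fin 3 → Fin K // IsDeep K (lvl3 Q) k} : ℝ) := by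
      have := (Nat.cast_le (α := ℝ)).2 hdeep; push_cast at this ⊢; linarith
    have h2 : ((Nat.card {k : Fin 3 → Fin K // IsDeep K (lvl3 Q) k} : ℕ) : ℝ) *
        (motifCharged η Q : ℝ) ≤ (Nat.card {u : BIdx Q K // ¬ IsChargeFree η (bpt Q K) u} : ℝ) := by
      exact_mod_cast hch
    nlinarith [Nat.cast_nonneg (α := ℝ) (motifCharged η Q)]
  -- `K ≥ 12·lvl3`: at least half of the lattice coordinates are deep
  have hhalf : (K : ℝ) ^ 3 / 2 ≤ (K : ℝ) ^ 3 - 6 * (lvl3 Q) * (K : ℝ) ^ 2 := by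
    have hK2 : (0 : ℝ) ≤ (K : ℝ) ^ 2 := by positivity
    have : 12 * (lvl3 Q : ℝ) * (K : ℝ) ^ 2 ≤ (K : ℝ) * (K : ℝ) ^ 2 :=
      mul_le_mul_of_nonneg_right hK12r hK2
    nlinarith
  -- so the block has charged fraction `≥ ρ/2`
  have hchK : ρ / 2 * ((Fintype.card (BIdx Q K) : ℕ) : ℝ) ≤ (charged η (blockConfig Q K) : ℝ) := by
    rw [charged_blockConfig_eq, hn]
    have hK3 : (0 : ℝ) ≤ (K : ℝ) ^ 3 / 2 := by positivity
    have h1 : (K : ℝ) ^ 3 / 2 * (ρ * Q.motif.card) ≤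
        ((K : ℝ) ^ 3 - 6 * (lvl3 Q) * (K : ℝ) ^ 2) * (motifCharged η Q : ℝ) :=
      mul_le_mul hhalf hρF (by positivity) (hK3.trans hhalf)
    linarith
  -- the phase gap on the block against the trial-state bound
  have hgap := hP _ (blockConfig Q K) (blockConfig_injective Q K) hchK
  have hE := hK K hKK₀
  rw [hn] at hgap hE
  have hpos : (0 : ℝ) < Q.motif.card * (K : ℝ) ^ 3 := by positivity
  exact le_of_mul_le_mul_left (hgap.trans hE) hpos

/-! ## Sub₁ implies the periodic phase gap -/

/-- **`QualitativeChargeGapWith η → PeriodicPhaseGapWith η`** (`0 ≤ η ≤ 1`; the converse of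
`qualitativeChargeGap_of_periodicPhaseGap`): given `ρ > 0`, the gap `g(ρ/2)` of Sub₁ bounds the energy per particle
of every periodic configuration with charged fraction `≥ ρ` from below by `e* + g(ρ/2)`, through block trial states
(`le_energyPerParticle_of_phaseGapWith`). [folklore] -/
theorem periodicPhaseGap_of_qualitativeChargeGap : ∀ η : ℝ, 0 ≤ η → η ≤ 1 → QualitativeChargeGapWith η → PeriodicPhaseGapWith η := by
  intro η hη0 hη1 h ρ hρ
  rw [qualitativeChargeGapWith_iff] at h
  obtain ⟨g, hg, hP⟩ := h (ρ / 2) (half_pos hρ)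
  exact ⟨g, hg, fun Q hQ => le_energyPerParticle_of_phaseGapWith hη0 hη1 hρ.le hP hQ⟩

/-- **Sub₁ is EQUIVALENT to its periodic form**: `QualitativeChargeGapWith η ↔ PeriodicPhaseGapWith η`
(`0 ≤ η ≤ 1`). [folklore] -/
theorem qualitativeChargeGap_iff_periodicPhaseGap {η : ℝ} (hη0 : 0 ≤ η) (hη1 : η ≤ 1) :
    QualitativeChargeGapWith η ↔ PeriodicPhaseGapWith η :=
  ⟨periodicPhaseGap_of_qualitativeChargeGap η hη0 hη1, qualitativeChargeGap_of_periodicPhaseGap hη1⟩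

/-- At the route's tolerance: `QualitativeChargeGapWith (1/100) ↔ PeriodicPhaseGapWith (1/100)`. [folklore] -/
theorem qualitativeChargeGap_iff_periodicPhaseGap_hundredth :
    QualitativeChargeGapWith (1 / 100) ↔ PeriodicPhaseGapWith (1 / 100) :=
  qualitativeChargeGap_iff_periodicPhaseGap (by norm_num) (by norm_num)

/-! ## Minimising sequences of periodic configurations -/

/-- **Under the periodic phase gap, minimising sequences of periodic configurations have charged fraction tending
to `0`**: for `ρ > 0`, eventually `e(Q n) < e* + g(ρ)`, hence `chargedFraction η (Q n) < ρ`. [folklore] -/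
theorem tendsto_chargedFraction_of_periodicPhaseGap {η : ℝ} (h : PeriodicPhaseGapWith η)
    {Q : ℕ → PeriodicConfiguration 3}
    (hQ : Tendsto (fun n => (Q n).energyPerParticle lennardJones) atTop (𝓝 eStar)) :
    Tendsto (fun n => chargedFraction η (Q n)) atTop (𝓝 0) := by
  rw [Metric.tendsto_atTop]
  intro ρ hρ
  obtain ⟨g, hg, hP⟩ := h ρ hρ
  have hlt : eStar < eStar + g := by linarith
  obtain ⟨N, hN⟩ := eventually_atTop.1 (hQ.eventually (eventually_lt_nhds hlt))
  refine ⟨N, fun n hn => ?_⟩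
  rw [Real.dist_eq, sub_zero, abs_of_nonneg (chargedFraction_nonneg _ _)]
  by_contra hle
  push Not at hle
  exact absurd (hP (Q n) hle) (not_le.2 (hN n hn))

/-- **Under Sub₁ (`QualitativeChargeGapWith (1/100)`), minimising sequences of periodic configurations have
charged fraction tending to `0`** — the periodic twin of the route target `ZeroChargeBulk`, now from the phase gap
alone (no pricing). [folklore] -/
theorem tendsto_periodic_chargedFraction_of_qualitativeChargeGap (h : QualitativeChargeGapWith (1 / 100))
    {Q : ℕ → PeriodicConfiguration 3}
    (hQ : Tendsto (fun n => (Q n).energyPerParticle lennardJones) atTop (𝓝 eStar)) :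
    Tendsto (fun n => chargedFraction (1 / 100) (Q n)) atTop (𝓝 0) :=
  tendsto_chargedFraction_of_periodicPhaseGap
    (periodicPhaseGap_of_qualitativeChargeGap _ (by norm_num) (by norm_num) h) hQ

end Summit.AtomisticToContinuum.Crystallization.Theorems.PricedLinkCensusLocalToGlobalPhaseGap

end
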